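import Literature.RingTheory.Etale.FormallyEtaleOfTopKaehlerPower
import Mathlib.AlgebraicGeometry.Morphisms.Etale
import HarnessLib

/-!
# The Jacobian criterion for étaleness — ring-homomorphism form

Topic `Literature/RingTheory/Etale` (proofs only; no definitions, no named facts).  The
differential criterion ★ `Literature.RingTheory.Etale.etale_specMap_of_isUnit_det` (EGA IV₄
Cor. (17.11.2) c) ⇒ b)) reads the map under test from the instance `algebraMap S T`.  In the
(W0) core of cell `hodgecm-mathlib` (road W of `r₀`) the chart ring `C = (B₁ ⊗_R B₂)_h` carries TWO
`(B₁ ⊗_R B₂)`-algebra structures — the localisation and the shear map `φ♯` — so the criterion is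
restated here for a RING HOMOMORPHISM `φ : S →+* T` over `k`, in the exact-basis currency
(`β i = d zᵢ`; Jacobian `α.det (d (φ zᵢ))ᵢ`), with the conclusions phrased on
`Spec.map (CommRingCat.ofHom φ)`: étale, hence flat and locally of finite presentation.

## Sources

* A. Grothendieck, J. Dieudonné, *Éléments de géométrie algébrique* IV₄, Publ. Math. IHÉS 32
  (1967), Cor. (17.11.2) c) ⇒ b), p. 84; Déf. (17.3.7). [EGAIV4]
-/

noncomputable section

universe u

namespace Literature.RingTheory.Etale

open KaehlerDifferential Module _root_.AlgebraicGeometry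

variable {k S T : Type u} [CommRing k] [CommRing S] [CommRing T] [Algebra k S] [Algebra k T]

/-- The Jacobian matrix of `T ⊗_S Ω[S⁄k] → Ω[T⁄k]` in the bases `1 ⊗ β`, `α`, for an EXACT basis
`β i = d zᵢ`, has determinant `α.det (d (φ zᵢ))ᵢ` (`φ = algebraMap S T`).
[cite: EGAIV4, Cor. (17.11.2), c) ⇒ b) (p. 84)] -/
theorem det_toMatrix_mapBaseChange_eq_det_D [Algebra S T] [IsScalarTower k S T]
    {ι : Type*} [Fintype ι] [DecidableEq ι] {z : ι → S} (β : Basis ι S Ω[S⁄k])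
    (hβ : ∀ i, β i = D k S (z i)) (α : Basis ι T Ω[T⁄k]) :
    (LinearMap.toMatrix (Algebra.TensorProduct.basis T β) α (mapBaseChange k S T)).det =
      α.det fun i => D k T (algebraMap S T (z i)) := by
  rw [Basis.det_apply]
  congr 1
  ext i j
  rw [LinearMap.toMatrix_apply, Basis.toMatrix_apply, Algebra.TensorProduct.basis_apply,
    mapBaseChange_tmul, one_smul, hβ, map_D]

/-- **Jacobian criterion for étaleness, ring-homomorphism form.** Let `k → S` be of finite type and
`k → T` formally smooth and of finite presentation, `φ : S →+* T` a `k`-algebra map, `β` a basis of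
`Ω[S⁄k]` of the form `β i = d zᵢ` and `α` a basis of `Ω[T⁄k]` on the same finite index type.  If the
Jacobian `α.det (d (φ zᵢ))ᵢ` is a unit of `T`, then `Spec T → Spec S` (i.e. `Spec.map φ`) is étale.
[cite: EGAIV4, Cor. (17.11.2), c) ⇒ b) (p. 84)] -/
theorem etale_specMap_of_isUnit_det_ringHom [Algebra.FormallySmooth k T] [Algebra.FiniteType k S]
    [Algebra.FinitePresentation k T] (φ : S →+* T) (hφ : φ.comp (algebraMap k S) = algebraMap k T)
    {ι : Type*} [Fintype ι] [DecidableEq ι] {z : ι → S} (β : Basis ι S Ω[S⁄k])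
    (hβ : ∀ i, β i = D k S (z i)) (α : Basis ι T Ω[T⁄k])
    (hΔ : IsUnit (α.det fun i => D k T (φ (z i)))) :
    AlgebraicGeometry.Etale (Spec.map (CommRingCat.ofHom φ)) := by
  letI : Algebra S T := φ.toAlgebra
  haveI : IsScalarTower k S T := IsScalarTower.of_algebraMap_eq fun x => by
    rw [RingHom.algebraMap_toAlgebra, ← RingHom.comp_apply, hφ]
  haveI : Algebra.FinitePresentation S T :=
    Algebra.FinitePresentation.of_restrict_scalars_finitePresentation k S T
  have h : IsUnit (LinearMap.toMatrix (Algebra.TensorProduct.basis T β) α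
      (mapBaseChange k S T)).det := by
    rw [det_toMatrix_mapBaseChange_eq_det_D β hβ α]
    exact hΔ
  exact etale_specMap_of_isUnit_det k S T β α h

/-- Flatness under the hypotheses of `etale_specMap_of_isUnit_det_ringHom` (étale ⇒ flat).
[cite: EGAIV4, Cor. (17.11.2), c) ⇒ b) (p. 84)] -/
theorem flat_specMap_of_isUnit_det_ringHom [Algebra.FormallySmooth k T] [Algebra.FiniteType k S]
    [Algebra.FinitePresentation k T] (φ : S →+* T) (hφ : φ.comp (algebraMap k S) = algebraMap k T)
    {ι : Type*} [Fintype ι] [DecidableEq ι] {z : ι → S} (β : Basis ι S Ω[S⁄k])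
    (hβ : ∀ i, β i = D k S (z i)) (α : Basis ι T Ω[T⁄k])
    (hΔ : IsUnit (α.det fun i => D k T (φ (z i)))) :
    Flat (Spec.map (CommRingCat.ofHom φ)) :=
  haveI := etale_specMap_of_isUnit_det_ringHom φ hφ β hβ α hΔ
  inferInstance

/-- Local finite presentation under the hypotheses of `etale_specMap_of_isUnit_det_ringHom`
(étale ⇒ locally of finite presentation). [cite: EGAIV4, Cor. (17.11.2), c) ⇒ b) (p. 84)] -/
theorem locallyOfFinitePresentation_specMap_of_isUnit_det_ringHom [Algebra.FormallySmooth k T]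
    [Algebra.FiniteType k S] [Algebra.FinitePresentation k T] (φ : S →+* T)
    (hφ : φ.comp (algebraMap k S) = algebraMap k T)
    {ι : Type*} [Fintype ι] [DecidableEq ι] {z : ι → S} (β : Basis ι S Ω[S⁄k])
    (hβ : ∀ i, β i = D k S (z i)) (α : Basis ι T Ω[T⁄k])
    (hΔ : IsUnit (α.det fun i => D k T (φ (z i)))) :
    LocallyOfFinitePresentation (Spec.map (CommRingCat.ofHom φ)) :=
  haveI := etale_specMap_of_isUnit_det_ringHom φ hφ β hβ α hΔ
  inferInstance

end Literature.RingTheory.Etale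

end
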